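import Summits.CriticalPhenomena.SAWScalingLimit.Theorems.SAWTotalPositivityCriticalBubbleBoundKestenCutExponents
import Summits.CriticalPhenomena.SAWScalingLimit.Theorems.SAWTotalPositivityCriticalBubbleBoundKestenColumnMassLeOne

/-!
# Line `kesten-product-renewal-dictionary` for the crux `SAWTotalPositivity.CriticalBubbleBound`
(stmt-CriticalPhenomena-7117): the certified REDUCTION of the crux to two named exponent conjectures

With the two-bridge cut (`Kesten.Cut.bubble_le_twoBridge`, p111001), Kesten's bound `u_h ≤ 1`
(`Kesten.Cut.columnMass_le_one`, p103353) and the parametric exponent bookkeeping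
(`Kesten.Cut.bubble_ne_top_of_exponents`, p112257) in the tree, the line's composition is a theorem:

  `DisjointnessGain (4/3) → PinnedLengthMassBound (1/4) → CriticalBubbleBound`

(`criticalBubbleBound_of_disjointnessGain_of_pinnedLengthMassBound`; parametric family
`criticalBubbleBound_of_exponents : a - c < -1 → DisjointnessGain c → PinnedLengthMassBound a → …`).
The two hypotheses are the line's OPEN stubs (registered on the crux item as `stub_disjointnessGain`,
`stub_pinnedLengthMassBound`), stated here as NAMED conjectures (`@[conjecture]`, obligation nodes of THIS
programme — provable or refutable by name; they are not results in print):

* `DisjointnessGain c` (restrictive, the bet of the line): under the free length-weighted mass `F(h)` of two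
  independent critical bridges of `ℤ²` from `0` and `(0,1)` meeting at a common apex in column `h`, the pairs
  that avoid each other except at the apex carry at most `C (h+1)^{-c}` of the mass: `M₂(h) ≤ C (h+1)^{-c} F(h)`.
  Coulomb-gas value `c = 3/2` (two boundary two-leg fusions, `2(x̃₂ - 2x̃₁) = 2(2 - 5/4)`, Duplantier–Saleur
  surface exponents); filed at `c = 4/3`. Proved: `c = 0` only (`disjointnessGain_zero`).
* `PinnedLengthMassBound a` (one-walk): the length-weighted mass of critical bridges pinned at any site of
  column `h`, `L(v) = Σ_{tip W = v} |W| x_c^{|W|}`, is `≤ C (h+1)^a`. Coulomb-gas value `a = 1/12`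
  (`h^{1/ν} · h^{-2x̃₁·1} = h^{4/3 - 5/4}`); filed at `a = 1/4`. Nothing proved (not even finiteness of
  `L(v)`, which needs `μ(strip) < μ`).

The chain: `M₂(h) ≤ C₁ (h+1)^{-c} F(h)` (gain), `F(h) ≤ 2 u_h sup_{v₀ = h} L(v)` (Fubini,
`Kesten.Cut.freePairMass_le`), `u_h ≤ 1` (Kesten), `sup L ≤ C₃ (h+1)^a` (pinned growth) give
`M₂(h) ≤ 2 C₁ C₃ (h+1)^{a-c}`, summable for `a - c < -1`; the two-bridge bound
`G_{x_c}(0,e₀) ≤ x_c + μ² Σ_h M₂(h)` and the one-number normal form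
`Negative.criticalBubbleBound_iff_bubble_e₀_ne_top` conclude the crux. Everything below is sorry-free;
the crux item is NOT closed by this file (the two conjectures are open). Also recorded: monotonicity of both
conjectures in their exponent and the trade-off line `a - c < -1` (`criticalBubbleBound_of_exponents`), so
that any future partial result on either side is consumed at face value.

Sources: N. Madras, G. Slade, *The Self-Avoiding Walk* (1993), §4.2 (Kesten's renewal structure), p. 37 (the
open problem); B. Duplantier, H. Saleur, Phys. Rev. Lett. 57 (1986) 3179 (surface exponents of polymer
networks, the heuristic values only).
-/

noncomputable section

open Literature.Probability.LatticeModels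
open Literature.Probability.RandomPlanarGeometry Literature.Probability.RandomPlanarGeometry.SAW
open scoped ENNReal NNReal BigOperators
open Summit.CriticalPhenomena.SAWScalingLimit.Theorems.CriticalBubbleBound.Negative

namespace Summit.CriticalPhenomena.SAWScalingLimit.Theorems.CriticalBubbleBound.Kesten

/-! ## The two open exponent statements of the line (named conjectures) -/

/-- **Disjointness gain with exponent `c`** (line conjecture of `kesten-product-renewal-dictionary`, crux
stmt-CriticalPhenomena-7117; registered stub `stub_disjointnessGain` at `c = 4/3`): for every column `h`,
`M₂(h) ≤ C (h+1)^{-c} F(h)` — mutual avoidance (except at the common apex) of two independent critical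
bridges of `ℤ²` started at `0` and `(0,1)` costs at least `(h+1)^{-c}` under the free length-weighted
apex-pinned pair mass. Heuristic value `c = 3/2` (boundary two-leg fusion at the start and at the apex,
`2(x̃₂ - 2x̃₁)` with `x̃₁ = 5/8`, `x̃₂ = 2`); open for every `c > 0` (no two-arm upper bound for critical
self-avoiding bridges is known; cf. Hammond's polygon joining, which caps at `θ ≥ 3/2` on density one).
[cite: DuplantierSaleur1986, eq. (3) (surface network exponents; heuristic value only)] -/
@[conjecture] def DisjointnessGain (c : ℝ) : Prop :=
  ∃ C : ℝ≥0, ∀ h : ℕ,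
    disjointPairMass h ≤ (C : ℝ≥0∞) * ENNReal.ofReal (((h : ℝ) + 1) ^ (-c)) * freePairMass h

/-- **Pinned length-weighted bridge mass with exponent `a`** (line conjecture of
`kesten-product-renewal-dictionary`, crux stmt-CriticalPhenomena-7117; registered stub
`stub_pinnedLengthMassBound` at `a = 1/4`): `sup_{v : v₀ = h} L(v) ≤ C (h+1)^a` where
`L(v) = Σ_{W bridge from 0, tip W = v} |W| x_c^{|W|}`. Heuristic value `a = 1/12` (`x_c`-mean length
`h^{1/ν} = h^{4/3}` of a span-`h` bridge times the pinned bridge two-point function `h^{-2x̃₁} = h^{-5/4}`);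
open for every real `a` (it contains a one-sided Flory bound for bridges; even `L(v) < ∞` needs
`μ(strip of width h) < μ`, not in the tree). [cite: MadrasSlade1993, §4.2 (objects); p. 37 (status)] -/
@[conjecture] def PinnedLengthMassBound (a : ℝ) : Prop :=
  ∃ C : ℝ≥0, ∀ (h : ℕ) (v : Site 2), v 0 = h →
    pinnedLengthMass v ≤ (C : ℝ≥0∞) * ENNReal.ofReal (((h : ℝ) + 1) ^ a)

/-! ## What is proved about them: the floor of the gain, monotonicity in the exponents -/

/-- The trivial disjointness gain `c = 0`: the avoidance constraint only removes mass, `M₂(h) ≤ F(h)`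
(`disjointPairMass_le_freePairMass`). This is the only proved instance. [folklore] -/
theorem disjointnessGain_zero : DisjointnessGain 0 := by
  refine ⟨1, fun h => ?_⟩
  have h1 : ENNReal.ofReal (((h : ℝ) + 1) ^ (-(0 : ℝ))) = 1 := by
    rw [neg_zero, Real.rpow_zero, ENNReal.ofReal_one]
  rw [h1, ENNReal.coe_one, one_mul, one_mul]
  exact disjointPairMass_le_freePairMass h

/-- A disjointness gain is inherited by every smaller exponent: `c' ≤ c → DisjointnessGain c →
DisjointnessGain c'` (`(h+1)^{-c} ≤ (h+1)^{-c'}`). [folklore] -/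
theorem disjointnessGain_anti {c c' : ℝ} (hc : c' ≤ c) : DisjointnessGain c → DisjointnessGain c' := by
  rintro ⟨C, hC⟩
  refine ⟨C, fun h => (hC h).trans ?_⟩
  have ht : (1 : ℝ) ≤ (h : ℝ) + 1 := by
    have : (0 : ℝ) ≤ (h : ℝ) := Nat.cast_nonneg h
    linarith
  gcongr

/-- A pinned growth bound is inherited by every larger exponent: `a ≤ a' → PinnedLengthMassBound a →
PinnedLengthMassBound a'`. [folklore] -/
theorem pinnedLengthMassBound_mono {a a' : ℝ} (ha : a ≤ a') :
    PinnedLengthMassBound a → PinnedLengthMassBound a' := by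
  rintro ⟨C, hC⟩
  refine ⟨C, fun h v hv => (hC h v hv).trans ?_⟩
  have ht : (1 : ℝ) ≤ (h : ℝ) + 1 := by
    have : (0 : ℝ) ≤ (h : ℝ) := Nat.cast_nonneg h
    linarith
  gcongr

/-! ## The reduction -/

/-- **The crux from the two exponent conjectures, parametric form** (line
`kesten-product-renewal-dictionary`): a disjointness gain `c` and a pinned growth bound `a` with
`a - c < -1` imply `CriticalBubbleBound`. Proof: `Kesten.Cut.bubble_ne_top_of_exponents` at `(c, 0, a)` with
Kesten's bound `u_h ≤ 1` (`Kesten.Cut.columnMass_le_one`) as the decay-`0` input, then the one-number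
normal form `Negative.criticalBubbleBound_iff_bubble_e₀_ne_top`. (Registered sub-goal of the crux item; the
crux itself stays open.) [folklore] -/
theorem criticalBubbleBound_of_exponents {a c : ℝ} (hac : a - c < -1) :
    DisjointnessGain c → PinnedLengthMassBound a →
      Summit.CriticalPhenomena.SAWScalingLimit.Theses.SAWTotalPositivity.CriticalBubbleBound := by
  intro hC hB1
  rw [criticalBubbleBound_iff_bubble_e₀_ne_top]
  refine Cut.bubble_ne_top_of_exponents (a := c) (b := 0) (c := a) (by linarith) hC ?_ hB1
  exact ⟨1, fun h => by simpa using Cut.columnMass_le_one h⟩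

/-- **The crux from the two registered stubs** (line `kesten-product-renewal-dictionary`, kernel-checked
composition with the landed stubs A1/A2/B2): disjointness gain `4/3` and pinned growth `1/4` imply
`CriticalBubbleBound` (`1/4 - 4/3 = -13/12 < -1`). (Registered sub-goal of the crux item; the crux itself
stays open: both hypotheses are open conjectures.) [folklore] -/
theorem criticalBubbleBound_of_disjointnessGain_of_pinnedLengthMassBound :
    DisjointnessGain (4 / 3) → PinnedLengthMassBound (1 / 4) →
      Summit.CriticalPhenomena.SAWScalingLimit.Theses.SAWTotalPositivity.CriticalBubbleBound :=
  criticalBubbleBound_of_exponents (a := 1 / 4) (c := 4 / 3) (by norm_num)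

/-- The trade-off line made explicit: with the heuristic gain `c < 3/2` the pinned growth exponent may be
anything below `1/2`; with the proved gain `c = 0` it would have to be below `-1` (false: `L` does not
decay). Any `c > 4/3 - 1/4 - 1 = 1/12` of PROVED gain would lower what B1 must deliver below its filed
`1/4`… precisely: gain `c` and growth `a` close the crux iff the pair lies strictly below the line
`a = c - 1`. [folklore] -/
theorem criticalBubbleBound_of_exponents' {a c : ℝ} (hac : a < c - 1) :
    DisjointnessGain c → PinnedLengthMassBound a →
      Summit.CriticalPhenomena.SAWScalingLimit.Theses.SAWTotalPositivity.CriticalBubbleBound :=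
  criticalBubbleBound_of_exponents (by linarith)

/-- **The crux from the two registered stubs after reshape r2** (line `kesten-product-renewal-dictionary`,
lead c2, 2026-08-16): disjointness gain `5/4` and pinned growth `1/5` imply `CriticalBubbleBound`
(`1/5 - 5/4 = -21/20 < -1`). The registration moved along the trade-off line after the Monte-Carlo test of
both stubs in their own normalisation (kit j018954, `h ≤ 32`, exact-enumeration-validated; record
`Cruxes/CriticalBubbleBound/Numerics-kesten-c2.md`): the effective exponent of `sup_v L(v)` is `0.10–0.12`
and falling towards the predicted `1/12`, that of `M₂/F` is `1.36 ± 0.02` (vs `h`) / `1.48 ± 0.02` (vs `h+1`)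
rising towards the predicted `3/2`; `(1/5, 5/4)` keeps visible margins on both. (Registered sub-goal of the
crux item; the crux itself stays open: both hypotheses are open conjectures.) [folklore] -/
theorem criticalBubbleBound_of_disjointnessGain_five_fourths_of_pinnedLengthMassBound_one_fifth :
    DisjointnessGain (5 / 4) → PinnedLengthMassBound (1 / 5) →
      Summit.CriticalPhenomena.SAWScalingLimit.Theses.SAWTotalPositivity.CriticalBubbleBound :=
  criticalBubbleBound_of_exponents (a := 1 / 5) (c := 5 / 4) (by norm_num)

end Summit.CriticalPhenomena.SAWScalingLimit.Theorems.CriticalBubbleBound.Kesten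

end
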